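import Mathlib
import Summits.Ventures.PercRepro2.Defs
import Summits.Ventures.PercRepro2.CoinKStarLattice
import Summits.Ventures.PercRepro2.CoinKStarTilt

/-!
# The k-STAR trace law and the avoidance-function vocabulary (blind cell PercRepro2, night-2 g5;
proofs/NIGHT2-DARC.md §26.1)

On the leaf lattice `2^{Vs}` the trace law of a k-star head `P = {w} ∪ Vs` is a PRODUCT:
`leafLaw L = ∏_{i ∈ Vs} (β i if i ∈ L else 1 − β i)` (the open leaves `L`) and
`armProd L = ∏_{i ∈ L} q i` (every arm into an open leaf closed, `q i = 1 − α i`); the trace `L`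
(`w ∉ K⁻`) has mass `kA L = leafLaw L · armProd L`, the trace `L ∪ {w}` has mass
`kB L = leafLaw L · (1 − armProd L)`.  `leafLaw` and `armProd` are log-modular, `armProd` is
decreasing, and the Holley dominations `kA L · kB L' ≤ kA (L ∩ L') · kB (L ∪ L')`,
`kA L · leafLaw L' ≤ kA (L ∩ L') · leafLaw (L ∪ L')` follow.  `ratio_mono`: the ratio
`F (S ∪ {z}) / F S` of a log-supermodular `F` increases with `S`.  `kLam`, `kMass`: the total
mass `Λ` and the avoided-marker mass `F_G` of the abstract k-star lemma.
-/

namespace Summit.Ventures.PercRepro2.Coin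

section KStarLaw

open Classical

variable {V : Type*} [Fintype V] [DecidableEq V] {R : Type*} [Field R] [LinearOrder R]
  [IsStrictOrderedRing R]

/-- The product law of the open leaves: `∏_{i ∈ Vs} (β i if i ∈ L else 1 − β i)`. -/
def leafLaw (Vs : Finset V) (β : V → R) (L : Finset V) : R :=
  ∏ i ∈ Vs, (if i ∈ L then β i else 1 - β i)

/-- The probability that every arm into `L` is closed: `∏_{i ∈ L} q i`. -/
def armProd (q : V → R) (L : Finset V) : R := ∏ i ∈ L, q i

/-- The trace mass of `L` (`w ∉ K⁻`). -/
def kA (Vs : Finset V) (β q : V → R) (L : Finset V) : R := leafLaw Vs β L * armProd q L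

/-- The trace mass of `L ∪ {w}` (`w ∈ K⁻`). -/
def kB (Vs : Finset V) (β q : V → R) (L : Finset V) : R := leafLaw Vs β L * (1 - armProd q L)

omit [Fintype V] in
/-- The leaf law is nonnegative for `β ∈ [0, 1]`. -/
lemma leafLaw_nonneg {Vs : Finset V} {β : V → R} (hβ0 : ∀ i ∈ Vs, 0 ≤ β i)
    (hβ1 : ∀ i ∈ Vs, β i ≤ 1) (L : Finset V) : 0 ≤ leafLaw Vs β L := by
  refine Finset.prod_nonneg fun i hi => ?_
  split_ifs
  · exact hβ0 i hi
  · linarith [hβ1 i hi]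

omit [Fintype V] [LinearOrder R] [IsStrictOrderedRing R] in
/-- The leaf law is log-modular. -/
lemma leafLaw_mul (Vs : Finset V) (β : V → R) (L L' : Finset V) :
    leafLaw Vs β L * leafLaw Vs β L' = leafLaw Vs β (L ∩ L') * leafLaw Vs β (L ∪ L') := by
  simp only [leafLaw]
  rw [← Finset.prod_mul_distrib, ← Finset.prod_mul_distrib]
  refine Finset.prod_congr rfl fun i _ => ?_
  by_cases h1 : i ∈ L <;> by_cases h2 : i ∈ L' <;> simp [h1, h2, mul_comm]

omit [Fintype V] [DecidableEq V] in
/-- The arm product is nonnegative for `q ≥ 0`. -/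
lemma armProd_nonneg {Vs : Finset V} {q : V → R} (hq0 : ∀ i ∈ Vs, 0 ≤ q i) {L : Finset V}
    (hL : L ⊆ Vs) : 0 ≤ armProd q L :=
  Finset.prod_nonneg fun i hi => hq0 i (hL hi)

omit [Fintype V] [DecidableEq V] in
/-- The arm product is at most `1` for `q ∈ [0, 1]`. -/
lemma armProd_le_one {Vs : Finset V} {q : V → R} (hq0 : ∀ i ∈ Vs, 0 ≤ q i)
    (hq1 : ∀ i ∈ Vs, q i ≤ 1) {L : Finset V} (hL : L ⊆ Vs) : armProd q L ≤ 1 :=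
  Finset.prod_le_one (fun i hi => hq0 i (hL hi)) (fun i hi => hq1 i (hL hi))

omit [Fintype V] [LinearOrder R] [IsStrictOrderedRing R] in
/-- The arm product is log-modular. -/
lemma armProd_mul (q : V → R) (L L' : Finset V) :
    armProd q L * armProd q L' = armProd q (L ∩ L') * armProd q (L ∪ L') := by
  simp only [armProd]
  rw [mul_comm (∏ i ∈ L ∩ L', q i), Finset.prod_union_inter]

omit [Fintype V] in
/-- The arm product is decreasing. -/
lemma armProd_anti {Vs : Finset V} {q : V → R} (hq0 : ∀ i ∈ Vs, 0 ≤ q i)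
    (hq1 : ∀ i ∈ Vs, q i ≤ 1) {L L' : Finset V} (hLL' : L ⊆ L') (hL' : L' ⊆ Vs) :
    armProd q L' ≤ armProd q L := by
  have h := Finset.prod_sdiff (f := q) hLL'
  simp only [armProd]
  rw [← h]
  have h1 : ∏ i ∈ L' \ L, q i ≤ 1 :=
    Finset.prod_le_one (fun i hi => hq0 i (hL' (Finset.mem_sdiff.mp hi).1))
      (fun i hi => hq1 i (hL' (Finset.mem_sdiff.mp hi).1))
  have h0 : 0 ≤ ∏ i ∈ L, q i := Finset.prod_nonneg fun i hi => hq0 i (hL' (hLL' hi))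
  calc (∏ i ∈ L' \ L, q i) * ∏ i ∈ L, q i ≤ 1 * ∏ i ∈ L, q i :=
        mul_le_mul_of_nonneg_right h1 h0
    _ = ∏ i ∈ L, q i := one_mul _

omit [Fintype V] [LinearOrder R] [IsStrictOrderedRing R] in
/-- `armProd` on the powerset is the product tilt of `CoinKStarTilt`. -/
lemma armProd_eq_tilt_factor {Vs : Finset V} (q : V → R) {L : Finset V} (hL : L ⊆ Vs) :
    ∏ j ∈ Vs, (if j ∈ L then q j else 1) = armProd q L := by
  rw [Finset.prod_ite_mem, Finset.inter_eq_right.mpr hL]; rfl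

omit [Fintype V] in
/-- The trace mass `kA` is nonnegative. -/
lemma kA_nonneg {Vs : Finset V} {β q : V → R} (hβ0 : ∀ i ∈ Vs, 0 ≤ β i)
    (hβ1 : ∀ i ∈ Vs, β i ≤ 1) (hq0 : ∀ i ∈ Vs, 0 ≤ q i) {L : Finset V} (hL : L ⊆ Vs) :
    0 ≤ kA Vs β q L :=
  mul_nonneg (leafLaw_nonneg hβ0 hβ1 L) (armProd_nonneg hq0 hL)

omit [Fintype V] in
/-- The trace mass `kB` is nonnegative. -/
lemma kB_nonneg {Vs : Finset V} {β q : V → R} (hβ0 : ∀ i ∈ Vs, 0 ≤ β i)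
    (hβ1 : ∀ i ∈ Vs, β i ≤ 1) (hq0 : ∀ i ∈ Vs, 0 ≤ q i) (hq1 : ∀ i ∈ Vs, q i ≤ 1) {L : Finset V}
    (hL : L ⊆ Vs) : 0 ≤ kB Vs β q L :=
  mul_nonneg (leafLaw_nonneg hβ0 hβ1 L) (by linarith [armProd_le_one hq0 hq1 hL])

omit [Fintype V] in
/-- `kA L ≤ leafLaw L` (the arm product is at most `1`). -/
lemma kA_le_leafLaw {Vs : Finset V} {β q : V → R} (hβ0 : ∀ i ∈ Vs, 0 ≤ β i)
    (hβ1 : ∀ i ∈ Vs, β i ≤ 1) (hq0 : ∀ i ∈ Vs, 0 ≤ q i) (hq1 : ∀ i ∈ Vs, q i ≤ 1) {L : Finset V}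
    (hL : L ⊆ Vs) : kA Vs β q L ≤ leafLaw Vs β L := by
  have := mul_le_mul_of_nonneg_left (armProd_le_one hq0 hq1 hL) (leafLaw_nonneg hβ0 hβ1 L)
  simpa [kA] using this

omit [Fintype V] [LinearOrder R] [IsStrictOrderedRing R] in
/-- `kA` is log-modular. -/
lemma kA_mul (Vs : Finset V) (β q : V → R) (L L' : Finset V) :
    kA Vs β q L * kA Vs β q L' = kA Vs β q (L ∩ L') * kA Vs β q (L ∪ L') := by
  simp only [kA]
  calc leafLaw Vs β L * armProd q L * (leafLaw Vs β L' * armProd q L')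
      = (leafLaw Vs β L * leafLaw Vs β L') * (armProd q L * armProd q L') := by ring
    _ = (leafLaw Vs β (L ∩ L') * leafLaw Vs β (L ∪ L')) *
        (armProd q (L ∩ L') * armProd q (L ∪ L')) := by rw [leafLaw_mul, armProd_mul]
    _ = _ := by ring

omit [Fintype V] in
/-- `kA · kB` domination: `kA L * kB L' ≤ kA (L ∩ L') * kB (L ∪ L')`. -/
lemma kA_mul_kB_le {Vs : Finset V} {β q : V → R} (hβ0 : ∀ i ∈ Vs, 0 ≤ β i)
    (hβ1 : ∀ i ∈ Vs, β i ≤ 1) (hq0 : ∀ i ∈ Vs, 0 ≤ q i) (hq1 : ∀ i ∈ Vs, q i ≤ 1)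
    {L L' : Finset V} (hL : L ⊆ Vs) (_hL' : L' ⊆ Vs) :
    kA Vs β q L * kB Vs β q L' ≤ kA Vs β q (L ∩ L') * kB Vs β q (L ∪ L') := by
  simp only [kA, kB]
  have hll := leafLaw_mul Vs β L L'
  have hpm := armProd_mul q L L'
  have hanti : armProd q L ≤ armProd q (L ∩ L') :=
    armProd_anti hq0 hq1 Finset.inter_subset_left hL
  have h0 : 0 ≤ leafLaw Vs β (L ∩ L') * leafLaw Vs β (L ∪ L') :=
    mul_nonneg (leafLaw_nonneg hβ0 hβ1 _) (leafLaw_nonneg hβ0 hβ1 _)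
  calc leafLaw Vs β L * armProd q L * (leafLaw Vs β L' * (1 - armProd q L'))
      = (leafLaw Vs β L * leafLaw Vs β L') * (armProd q L - armProd q L * armProd q L') := by ring
    _ = (leafLaw Vs β (L ∩ L') * leafLaw Vs β (L ∪ L')) *
        (armProd q L - armProd q (L ∩ L') * armProd q (L ∪ L')) := by rw [hll, hpm]
    _ ≤ (leafLaw Vs β (L ∩ L') * leafLaw Vs β (L ∪ L')) *
        (armProd q (L ∩ L') - armProd q (L ∩ L') * armProd q (L ∪ L')) :=
        mul_le_mul_of_nonneg_left (by linarith) h0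
    _ = leafLaw Vs β (L ∩ L') * armProd q (L ∩ L') *
        (leafLaw Vs β (L ∪ L') * (1 - armProd q (L ∪ L'))) := by ring

omit [Fintype V] in
/-- `kA · leafLaw` domination: `kA L * leafLaw L' ≤ kA (L ∩ L') * leafLaw (L ∪ L')`. -/
lemma kA_mul_leafLaw_le {Vs : Finset V} {β q : V → R} (hβ0 : ∀ i ∈ Vs, 0 ≤ β i)
    (hβ1 : ∀ i ∈ Vs, β i ≤ 1) (hq0 : ∀ i ∈ Vs, 0 ≤ q i) (hq1 : ∀ i ∈ Vs, q i ≤ 1)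
    {L L' : Finset V} (hL : L ⊆ Vs) (_hL' : L' ⊆ Vs) :
    kA Vs β q L * leafLaw Vs β L' ≤ kA Vs β q (L ∩ L') * leafLaw Vs β (L ∪ L') := by
  simp only [kA]
  have hll := leafLaw_mul Vs β L L'
  have hanti : armProd q L ≤ armProd q (L ∩ L') :=
    armProd_anti hq0 hq1 Finset.inter_subset_left hL
  have h0 : 0 ≤ leafLaw Vs β (L ∩ L') * leafLaw Vs β (L ∪ L') :=
    mul_nonneg (leafLaw_nonneg hβ0 hβ1 _) (leafLaw_nonneg hβ0 hβ1 _)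
  calc leafLaw Vs β L * armProd q L * leafLaw Vs β L'
      = (leafLaw Vs β L * leafLaw Vs β L') * armProd q L := by ring
    _ = (leafLaw Vs β (L ∩ L') * leafLaw Vs β (L ∪ L')) * armProd q L := by rw [hll]
    _ ≤ (leafLaw Vs β (L ∩ L') * leafLaw Vs β (L ∪ L')) * armProd q (L ∩ L') :=
        mul_le_mul_of_nonneg_left hanti h0
    _ = _ := by ring

/-! ### Set identities for the extra vertices `w, u, a, b ∉ Vs` -/

omit [Fintype V] [Field R] [LinearOrder R] [IsStrictOrderedRing R] in
/-- `insert z S ∩ S' = S ∩ S'` when `z ∉ S'`. -/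
lemma insert_inter_of_notMem' {z : V} {S S' : Finset V} (h : z ∉ S') :
    insert z S ∩ S' = S ∩ S' := by
  ext x; simp only [Finset.mem_inter, Finset.mem_insert]
  constructor
  · rintro ⟨hx, hx'⟩
    rcases hx with rfl | hx
    · exact absurd hx' h
    · exact ⟨hx, hx'⟩
  · rintro ⟨hx, hx'⟩; exact ⟨Or.inr hx, hx'⟩

omit [Fintype V] [Field R] [LinearOrder R] [IsStrictOrderedRing R] in
/-- `insert z S ∪ S' = insert z (S ∪ S')`. -/
lemma insert_union' (z : V) (S S' : Finset V) : insert z S ∪ S' = insert z (S ∪ S') := by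
  ext x; simp only [Finset.mem_union, Finset.mem_insert]; tauto

omit [Fintype V] [Field R] [LinearOrder R] [IsStrictOrderedRing R] in
/-- `insert z S ∩ insert z S' = insert z (S ∩ S')`. -/
lemma insert_inter_insert'' (z : V) (S S' : Finset V) :
    insert z S ∩ insert z S' = insert z (S ∩ S') := by
  ext x; simp only [Finset.mem_inter, Finset.mem_insert]; tauto

omit [Fintype V] [Field R] [LinearOrder R] [IsStrictOrderedRing R] in
/-- `insert z S ∪ insert z S' = insert z (S ∪ S')`. -/
lemma insert_union_insert'' (z : V) (S S' : Finset V) :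
    insert z S ∪ insert z S' = insert z (S ∪ S') := by
  ext x; simp only [Finset.mem_union, Finset.mem_insert]; tauto

/-! ### The avoidance-function ratios -/

omit [Fintype V] in
/-- The ratio `F (insert z S) / F S` increases with `S` (log-supermodularity of `F`), for `z ∉ S'`. -/
lemma ratio_mono {F : Finset V → R} (hFlsm : ∀ S S', F S * F S' ≤ F (S ∩ S') * F (S ∪ S'))
    {z : V} {S S' : Finset V} (hSS' : S ⊆ S') (hz : z ∉ S') (hS : 0 < F S) (hS' : 0 < F S') :
    F (insert z S) / F S ≤ F (insert z S') / F S' := by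
  rw [div_le_div_iff₀ hS hS']
  have h := hFlsm (insert z S) S'
  rw [insert_inter_of_notMem' hz, Finset.inter_eq_left.mpr hSS', insert_union',
    Finset.union_eq_right.mpr hSS'] at h
  linarith

omit [Fintype V] in
/-- The same without `z ∉ S'`: if `z ∈ S'` the right-hand ratio is `1` (and every ratio is `≤ 1`
since `F` is decreasing). -/
lemma ratio_mono' {F : Finset V → R} (hFdec : ∀ S S', S ⊆ S' → F S' ≤ F S)
    (hFlsm : ∀ S S', F S * F S' ≤ F (S ∩ S') * F (S ∪ S')) {z : V} {S S' : Finset V}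
    (hSS' : S ⊆ S') (hS : 0 < F S) (hS' : 0 < F S') :
    F (insert z S) / F S ≤ F (insert z S') / F S' := by
  by_cases hz : z ∈ S'
  · rw [Finset.insert_eq_of_mem hz, div_self hS'.ne']
    exact (div_le_one₀ hS).mpr (hFdec _ _ (Finset.subset_insert z S))
  · exact ratio_mono hFlsm hSS' hz hS hS'

/-- The total mass `Λ = Σ_L (kA L · F L + kB L · F (L ∪ {w}))`. -/
def kLam (Vs : Finset V) (β q : V → R) (w : V) (F : Finset V → R) : R :=
  ∑ L ∈ Vs.powerset, (kA Vs β q L * F L + kB Vs β q L * F (insert w L))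

/-- The avoided-marker mass `F_G = Σ_L (kA L · G L + kB L · G (L ∪ {w}))` of a marker mass `G`
(`G S = F (S ∪ {a})` for the point marker `a`, `G S = E[1 − F₁; R_{S ∪ {t}}]` for a cluster
functional `F₁`). -/
def kMass (Vs : Finset V) (β q : V → R) (w : V) (G : Finset V → R) : R :=
  ∑ L ∈ Vs.powerset, (kA Vs β q L * G L + kB Vs β q L * G (insert w L))

omit [Fintype V] in
/-- The cleared ratio monotonicity of the point-marker mass `S ↦ F (insert z S)`:
`F (insert z S) · F S' ≤ F (insert z S') · F S` for `S ⊆ S'` (log-supermodularity when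
`z ∉ S'`, monotonicity of `F` when `z ∈ S'`). -/
lemma insert_ratio_cleared {F : Finset V → R} (hF0 : ∀ S, 0 ≤ F S)
    (hFdec : ∀ S S', S ⊆ S' → F S' ≤ F S)
    (hFlsm : ∀ S S', F S * F S' ≤ F (S ∩ S') * F (S ∪ S')) (z : V) {S S' : Finset V}
    (hSS' : S ⊆ S') : F (insert z S) * F S' ≤ F (insert z S') * F S := by
  by_cases hz : z ∈ S'
  · rw [Finset.insert_eq_of_mem hz]
    calc F (insert z S) * F S' ≤ F S * F S' :=
          mul_le_mul_of_nonneg_right (hFdec _ _ (Finset.subset_insert z S)) (hF0 _)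
      _ = F S' * F S := mul_comm _ _
  · have h := hFlsm (insert z S) S'
    rw [insert_inter_of_notMem' hz, Finset.inter_eq_left.mpr hSS', insert_union',
      Finset.union_eq_right.mpr hSS'] at h
    linarith [mul_comm (F S) (F (insert z S'))]

end KStarLaw

end Summit.Ventures.PercRepro2.Coin
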